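import Mathlib

/-!
# Bernstein regrouping of a three-copy sum over product Bernoulli laws
(blind cell PercRepro2, mine-2 g15; the generic (S3) regrouping of the hub theorems —
MINE2-HUB.md §2 (b), MINE2-A3FIRST.md §3)

For a product Bernoulli law `bern q w = ∏_i (if w i then q i else 1 − q i)` on states `w : ι → Bool`
and any three-copy kernel `g`, the sum over ordered triples of states regroups by the TYPE vector
`k = w¹ + w² + w³ : ι → ℕ` (the number of copies in which coordinate `i` is on):

  `∑_{w¹ w² w³} g w¹ w² w³ · bern q w¹ · bern q w² · bern q w³
     = ∑_{k} (∑_{w¹ + w² + w³ = k} g w¹ w² w³) · ∏_i q_i^{k_i} (1 − q_i)^{3 − k_i}`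

(`sum_three_bern_eq_sum_type`): the inner sums are the typed hub coefficients `C_k` and the outer
weights the Bernstein basis in the effective edge weights `q`. The only ingredients are
`Finset.sum_fiberwise` and the per-coordinate identity `bern_mul_three` (eight cases of Booleans).
-/

namespace Summit.Ventures.PercRepro2.Bernstein3

variable {ι : Type*} [Fintype ι] [DecidableEq ι] {R : Type*} [CommRing R]

/-- The product Bernoulli law of a state. -/
def bern (q : ι → R) (w : ι → Bool) : R := ∏ i, (if w i then q i else 1 - q i)

/-- The type vector of a triple of states: the number of copies in which coordinate `i` is on. -/
def typeOf (w₁ w₂ w₃ : ι → Bool) : ι → ℕ := fun i => (if w₁ i then 1 else 0) + (if w₂ i then 1 else 0) + (if w₃ i then 1 else 0)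

/-- The Bernstein weight of a type vector. -/
def bernType (q : ι → R) (k : ι → ℕ) : R := ∏ i, q i ^ k i * (1 - q i) ^ (3 - k i)

/-- One coordinate: the three Bernoulli factors multiply to the Bernstein factor of the type. -/
lemma bern_factor_three (x : R) (b₁ b₂ b₃ : Bool) :
    (if b₁ then x else 1 - x) * (if b₂ then x else 1 - x) * (if b₃ then x else 1 - x) =
      x ^ ((if b₁ then 1 else 0) + (if b₂ then 1 else 0) + (if b₃ then 1 else 0)) *
        (1 - x) ^ (3 - ((if b₁ then 1 else 0) + (if b₂ then 1 else 0) + (if b₃ then 1 else 0))) := by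
  cases b₁ <;> cases b₂ <;> cases b₃ <;> simp <;> ring

omit [DecidableEq ι] in
/-- **The product of the three Bernoulli laws is the Bernstein weight of the type vector.** -/
theorem bern_mul_three (q : ι → R) (w₁ w₂ w₃ : ι → Bool) :
    bern q w₁ * bern q w₂ * bern q w₃ = bernType q (typeOf w₁ w₂ w₃) := by
  unfold bern bernType typeOf
  rw [← Finset.prod_mul_distrib, ← Finset.prod_mul_distrib]
  refine Finset.prod_congr rfl fun i _ => ?_
  exact bern_factor_three (q i) (w₁ i) (w₂ i) (w₃ i)

/-- The type vectors: functions `ι → ℕ` with values `≤ 3` (a finite set). -/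
def types : Finset (ι → ℕ) := Fintype.piFinset fun _ => Finset.range 4

/-- The type of a triple of states is a type vector. -/
lemma typeOf_mem_types (w₁ w₂ w₃ : ι → Bool) : typeOf w₁ w₂ w₃ ∈ (types : Finset (ι → ℕ)) := by
  simp only [types, Fintype.mem_piFinset, Finset.mem_range, typeOf]
  intro i
  cases w₁ i <;> cases w₂ i <;> cases w₃ i <;> simp

/-- **Bernstein regrouping**: a three-copy sum against the product law is the sum over type
vectors of the typed coefficient times the Bernstein weight. -/
theorem sum_three_bern_eq_sum_type (q : ι → R) (g : (ι → Bool) → (ι → Bool) → (ι → Bool) → R) :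
    (∑ w₁, ∑ w₂, ∑ w₃, g w₁ w₂ w₃ * (bern q w₁ * bern q w₂ * bern q w₃)) =
      ∑ k ∈ (types : Finset (ι → ℕ)),
        (∑ w₁, ∑ w₂, ∑ w₃, if typeOf w₁ w₂ w₃ = k then g w₁ w₂ w₃ else 0) * bernType q k := by
  classical
  set T : (ι → Bool) → (ι → Bool) → (ι → Bool) → (ι → ℕ) → R :=
    fun w₁ w₂ w₃ k => (if typeOf w₁ w₂ w₃ = k then g w₁ w₂ w₃ else 0) * bernType q k with hT
  -- every term is its own fibre sum
  have h1 : ∀ w₁ w₂ w₃, g w₁ w₂ w₃ * (bern q w₁ * bern q w₂ * bern q w₃) =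
      ∑ k ∈ (types : Finset (ι → ℕ)), T w₁ w₂ w₃ k := by
    intro w₁ w₂ w₃
    rw [Finset.sum_eq_single (typeOf w₁ w₂ w₃)]
    · simp only [hT, bern_mul_three, ite_true]
    · intro k _ hk
      simp only [hT, if_neg (Ne.symm hk), zero_mul]
    · intro h
      exact absurd (typeOf_mem_types w₁ w₂ w₃) h
  -- move the type sum outside, one binder at a time
  have s3 : ∀ w₁ w₂, (∑ w₃, ∑ k ∈ (types : Finset (ι → ℕ)), T w₁ w₂ w₃ k) =
      ∑ k ∈ (types : Finset (ι → ℕ)), ∑ w₃, T w₁ w₂ w₃ k := fun _ _ => Finset.sum_comm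
  have s2 : ∀ w₁, (∑ w₂, ∑ k ∈ (types : Finset (ι → ℕ)), ∑ w₃, T w₁ w₂ w₃ k) =
      ∑ k ∈ (types : Finset (ι → ℕ)), ∑ w₂, ∑ w₃, T w₁ w₂ w₃ k := fun _ => Finset.sum_comm
  have s1 : (∑ w₁, ∑ k ∈ (types : Finset (ι → ℕ)), ∑ w₂, ∑ w₃, T w₁ w₂ w₃ k) =
      ∑ k ∈ (types : Finset (ι → ℕ)), ∑ w₁, ∑ w₂, ∑ w₃, T w₁ w₂ w₃ k := Finset.sum_comm
  simp only [h1, s3, s2]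
  rw [s1]
  refine Finset.sum_congr rfl fun k _ => ?_
  simp only [hT, Finset.sum_mul]

end Summit.Ventures.PercRepro2.Bernstein3
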